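import Literature.NumberTheory.Automorphic.Liu2021.AppendixC.JacobianFanPullbackWordDeck
import HarnessLib

/-!
# The fan pull-back word with its MULTIPLICITY EXPOSED: `m c′ = #{δ ∈ Δ | act δ` restricts to the identity of the piece `E_N c′}`
# (Lang VIII §6 Thm. 13; LR22 Prop. 3.5.1; SGA 1 V §1) — and the assembly re-cut over arbitrary pinned entries

Topic `NumberTheory/Automorphic/Liu2021/AppendixC`; namespace `Literature.NumberTheory.Automorphic.Liu2021.AppendixC` (prefix `Jacobian.`).
PROOF FILE (theorems only; no definition, no named fact, no instance, no `sorry`).  Sequel of ★ `JacobianFanPullbackWord` and ★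
`JacobianFanPullbackWordDeck` (same setting, over `ℂ`: a quotient `p : X′ → X = X′/Δ` of a projective scheme by a finite group for separated
test objects, colimit cofans `eN c′ : E_N c′ → X′`, `eK c : E_K c → X` of smooth projective curves with Jacobians, biproduct fans `πN/ιN`,
`πK/ιK` on `Y_N`, `Y_K`, the piece maps `tu c′ : E_N c′ → E_K (bN c′)` of `p`, piece lifts `tδ δ c′` of the `act δ`, the lift matrices `M δ c₁ c₂`).

WHY THIS FILE.  ★ `Jacobian.exists_fan_pullback_word` hides the multiplicity `m c′` behind an `∃`; consumers that must MATCH weights across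
several deck groups (the d6 `slot_letters` closure, cell `hodgecm-mathlib`) need it as a known integer.  It is the order of the POINTWISE
STABILISER of the piece, `m c′ = #{δ ∈ Δ | eN c′ ≫ (act δ).hom = eN c′}` (= `#ker(Stab_Δ(c′) → Aut (E_N c′))` by uniqueness of lifts).  For a
Shimura curve it is the order of the global kernel of `act` (Hecke-translate rigidity: a translate fixing a non-empty open is the identity),
hence CONSTANT in `c′`; this file stays generic and only exposes the count.

* `Jacobian.fan_pinning_of_pinned` — the Y-level pinning `Wu ≫ Wt[T] = Σ_δ W_δ` for ANY entries `T c′` pinned by `Nm_{tu c′} ≫ T c′ = Σ_δ M δ c′ c′`;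
* `Jacobian.fan_word_cancel` — `Wu` is right-cancellable whenever every `tu c′` is a finite-group quotient for separated test objects;
* `Jacobian.fan_deck_of_pinned` — `Wt[T] ≫ W_d = Wt[T]` for such `T` (★ `Jacobian.sum_pieceLift_word_comp_eq` + cancellation);
* **`Jacobian.exists_piece_pullback_pinned_card`** — ★ `Jacobian.exists_piece_pullback_pinned` with `m := Nat.card {δ // eN c′ ≫ (act δ).hom = eN c′}`
  written INTO the statement (`0 < m`, the `H`-pinning of `ttH`, and `Nm_{tu} ≫ (m • ttH) = Σ_δ M δ c′ c′`).

Cell `hodgecm-mathlib` (D-0151), crux `HLiu418` = stmt-HodgeConjecture-24832, d6 line, `stub_RosH` glue, (L)-pen ruling 2026-08-30 06:09Z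
((PF)/Hecke-translate rigidity); consumed by the sequel `HeckeTraceWordPiecesRigid`.  COUNT-NEUTRAL capital: HC_CM is proved only modulo the 7
printed citations until rung 0 closes.

## References
* [Lang1983AbelianVarieties] S. Lang, *Abelian Varieties* (1983), Ch. VIII §6 Thm. 13 (pp. 224–227).
* [LangeRodriguez2022] H. Lange, R. E. Rodríguez, *Decomposition of Jacobians by Prym Varieties*, LNM 2310 (2022), §3.5.1 Prop. 3.5.1 (p. 65).
* [Lange2023AbelianVarietiesComplex] H. Lange, *Abelian Varieties over the Complex Numbers* (2023), §4.5.2 (the norm map `N_f`).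
* [SGA1] A. Grothendieck, M. Raynaud, *SGA 1*, Exp. V §1 Prop. 1.1, 1.8.
* [MumfordAV1970] D. Mumford, *Abelian Varieties* (1970), §7 Thm. p. 66 and Remark.
* [GortzWedhorn2020] U. Görtz, T. Wedhorn, *Algebraic Geometry I* (2nd ed.), §(3.5) Prop. 3.10, Example 3.11 (p. 73).
-/

set_option autoImplicit false

noncomputable section

open CategoryTheory CategoryTheory.Limits AlgebraicGeometry
open Literature.AlgebraicGeometry.Motives
open Literature.AlgebraicGeometry.Morphisms (Over.exists_stabilizer_action_on_piece Over.pieceMap_unique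
  Over.pieceMap_index_unique Over.exists_pieceMap_of_isColimit_cofan_of_irreducibleSpace)

namespace Literature.NumberTheory.Automorphic.Liu2021.AppendixC

section FanCard

variable {X' X : SchemeOver ℂ} {Δ : Type} [Group Δ] [Fintype Δ] (act : Δ →* Aut X') (p : X' ⟶ X)
  -- pieces of `X'`
  {CN : Type} [Fintype CN] (EN : CN → SchemeOver ℂ) (eN : ∀ c, EN c ⟶ X')
  (JN : ∀ c, Jacobian (EN c))
  -- pieces of `X`
  {CK : Type} [Fintype CK] (EK : CK → SchemeOver ℂ) (eK : ∀ c, EK c ⟶ X)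
  (JK : ∀ c, Jacobian (EK c))
  -- piece maps of `p`
  (bN : CN → CK) (tu : ∀ c', EN c' ⟶ EK (bN c'))

open scoped Classical in
/-- **THE FAN PINNING for ANY pinned entries** (★ `Jacobian.exists_fan_pullback_word`, re-cut universally over the per-piece data): if every
`T c′ : J_K(bN c′) → J_N(c′)` is pinned by the full stabiliser count, `Nm_{tu c′} ≫ T c′ = Σ_δ M δ c′ c′` (`M` = the lift matrix of the
`act δ`), then `Wu ≫ Wt[T] = Σ_δ W_δ` for `Wu := Σ_{c′} πN c′ ≫ Nm_{tu c′} ≫ ιK (bN c′)`, `Wt[T] := Σ_{c′} πK (bN c′) ≫ T c′ ≫ ιN c′` and the words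
`W_δ` of any piece lifts `tδ` of the `act δ` (Y-level `p^* p_* = Σ_δ δ_*`, [LangeRodriguez2022] Prop. 3.5.1; matrix forms ★
`Jacobian.fan_pieceMap_word_eq_sum` / ★ `fan_pieceLift_word_eq_sum`, entries ★ `Jacobian.fan_entry_pinning`).
[cite: LangeRodriguez2022, §3.5.1 Prop. 3.5.1 (p. 65)] [cite: Lang1983AbelianVarieties, Ch. VIII §6, Thm. 13 (pp. 224–227)] -/
theorem Jacobian.fan_pinning_of_pinned {YN YK : AbelianVariety ℂ}
    (πN : ∀ c, YN ⟶ (JN c).J) (ιN : ∀ c, (JN c).J ⟶ YN) (πK : ∀ c, YK ⟶ (JK c).J) (ιK : ∀ c, (JK c).J ⟶ YK)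
    (hιπK : ∀ c, ιK c ≫ πK c = 𝟙 _) (hιπK' : ∀ c₁ c₂, c₁ ≠ c₂ → ιK c₁ ≫ πK c₂ = 0)
    (hX' : IsProjectiveOver X') (hX : IsSeparated X.hom) (hp : IsSepQuotient (fun δ => act δ) p)
    (hcN : IsColimit (Cofan.mk X' eN)) (hEN : ∀ c, IsSmoothProjective 1 (EN c))
    (hcK : IsColimit (Cofan.mk X eK)) (hEK : ∀ c, IsSmoothProjective 1 (EK c))
    (htu : ∀ c', tu c' ≫ eK (bN c') = eN c' ≫ p)
    (φδ : Δ → CN → CN) (tδ : ∀ δ c', EN c' ⟶ EN (φδ δ c'))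
    (htδ : ∀ δ c', tδ δ c' ≫ eN (φδ δ c') = eN c' ≫ (act δ).hom)
    (T : ∀ c', (JK (bN c')).J ⟶ (JN c').J)
    (hT : ∀ c', (JN c').pushforward (JK (bN c')) (tu c') ≫ T c' =
      ∑ δ : Δ, if hℓ : ∃ ℓ : EN c' ⟶ EN c', ℓ ≫ eN c' = eN c' ≫ (act δ).hom
        then (JN c').pushforward (JN c') hℓ.choose else 0) :
    (∑ c', πN c' ≫ (JN c').pushforward (JK (bN c')) (tu c') ≫ ιK (bN c')) ≫ (∑ c', πK (bN c') ≫ T c' ≫ ιN c') =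
      ∑ δ, ∑ c', πN c' ≫ (JN c').pushforward (JN (φδ δ c')) (tδ δ c') ≫ ιN (φδ δ c') := by
  haveI : ∀ c, IsIntegral (EN c).left := fun c => IsSmoothProjective.isIntegral_holds (hEN c)
  rw [Preadditive.sum_comp, Finset.sum_comm]
  refine Finset.sum_congr rfl fun c₁ _ => ?_
  -- the word of `tu c₁` in matrix form, composed with `Wt`
  rw [Jacobian.fan_pieceMap_word_eq_sum p EN eN JN EK eK JK bN tu πN ιK hcK htu c₁, Preadditive.sum_comp,
    Finset.sum_congr rfl fun c _ => (Preadditive.comp_sum _ _ _), Finset.sum_comm]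
  -- collapse the middle contraction `ιK c ≫ πK (bN c₂)`
  have hcol : ∀ c₂ : CN,
      (∑ c, (πN c₁ ≫ (if h : ∃ τ : EN c₁ ⟶ EK c, τ ≫ eK c = eN c₁ ≫ p
          then (JN c₁).pushforward (JK c) h.choose else 0) ≫ ιK c) ≫ (πK (bN c₂) ≫ T c₂ ≫ ιN c₂)) =
      πN c₁ ≫ ((if h : ∃ τ : EN c₁ ⟶ EK (bN c₂), τ ≫ eK (bN c₂) = eN c₁ ≫ p
          then (JN c₁).pushforward (JK (bN c₂)) h.choose else 0) ≫ T c₂) ≫ ιN c₂ := by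
    intro c₂
    rw [Finset.sum_eq_single (bN c₂)]
    · simp only [Category.assoc]
      rw [reassoc_of% (hιπK (bN c₂))]
    · intro c _ hc
      simp only [Category.assoc]
      rw [reassoc_of% (hιπK' c (bN c₂) hc), zero_comp, comp_zero, comp_zero]
    · intro h; exact absurd (Finset.mem_univ _) h
  rw [Finset.sum_congr rfl fun c₂ _ => hcol c₂]
  -- the entry identity, then back to the words of the piece lifts
  rw [Finset.sum_congr rfl fun c₂ _ => by
    rw [Jacobian.fan_entry_pinning act p EN eN JN EK eK JK bN tu hX' hX hp hcN hEN hcK hEK htu c₁ c₂ _ (hT c₂),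
      Preadditive.sum_comp, Preadditive.comp_sum]]
  rw [Finset.sum_comm]
  refine Finset.sum_congr rfl fun δ _ => ?_
  rw [Jacobian.fan_pieceLift_word_eq_sum act EN eN JN πN ιN hcN δ c₁ (tδ δ c₁) (htδ δ c₁)]

/-- **The word of `p_*` is right-cancellable** against homomorphisms of abelian varieties (★ `Jacobian.exists_fan_pullback_word`, re-cut
universally): if every piece map `tu c′` is a quotient of `E_N c′` by a finite group `H c′ ≤ Aut (E_N c′)` for separated test objects, then
`Wu ≫ a = Wu ≫ b → a = b` for `Wu := Σ_{c′} πN c′ ≫ Nm_{tu c′} ≫ ιK (bN c′)` (each `Nm_{tu c′}` is right-cancellable, ★ `Jacobian.eq_of_pushforward_comp_eq`;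
every piece of `X` lies under a piece of `X′`, ★ `IsSepQuotient.surjective_map_of_isProjectiveOver`). [cite: MumfordAV1970, §7 Thm. p. 66 and Remark]
[cite: SGA1, Exp. V §1 Prop. 1.1] [cite: Lange2023AbelianVarietiesComplex, §4.5.2 (the norm map N_f)] -/
theorem Jacobian.fan_word_cancel {YN YK : AbelianVariety ℂ}
    (πN : ∀ c, YN ⟶ (JN c).J) (ιN : ∀ c, (JN c).J ⟶ YN) (πK : ∀ c, YK ⟶ (JK c).J) (ιK : ∀ c, (JK c).J ⟶ YK)
    (hιπN : ∀ c, ιN c ≫ πN c = 𝟙 _) (hιπN' : ∀ c₁ c₂, c₁ ≠ c₂ → ιN c₁ ≫ πN c₂ = 0)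
    (htotK : ∑ c, πK c ≫ ιK c = 𝟙 YK)
    (hX' : IsProjectiveOver X') (hX : IsSeparated X.hom) (hp : IsSepQuotient (fun δ => act δ) p)
    (hcN : IsColimit (Cofan.mk X' eN)) (hEN : ∀ c, IsSmoothProjective 1 (EN c))
    (hcK : IsColimit (Cofan.mk X eK)) (hEK : ∀ c, IsSmoothProjective 1 (EK c))
    (htu : ∀ c', tu c' ≫ eK (bN c') = eN c' ≫ p)
    (H : ∀ c', Subgroup (Aut (EN c'))) (hq : ∀ c', IsSepQuotient (fun h : ↥(H c') => (h : Aut (EN c'))) (tu c'))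
    ⦃Z : AbelianVariety ℂ⦄ ⦃a b : YK ⟶ Z⦄
    (hab : (∑ c', πN c' ≫ (JN c').pushforward (JK (bN c')) (tu c') ≫ ιK (bN c')) ≫ a =
      (∑ c', πN c' ≫ (JN c').pushforward (JK (bN c')) (tu c') ≫ ιK (bN c')) ≫ b) : a = b := by
  haveI : ∀ c, IsIntegral (EN c).left := fun c => IsSmoothProjective.isIntegral_holds (hEN c)
  haveI : ∀ c, IsIntegral (EK c).left := fun c => IsSmoothProjective.isIntegral_holds (hEK c)
  -- every piece inclusion `ιK (bN c′)` equalises `a` and `b`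
  have hι : ∀ c', ιK (bN c') ≫ a = ιK (bN c') ≫ b := by
    intro c'
    obtain ⟨P₀⟩ := (hEN c').nonempty_algPoints ℂ
    refine (JN c').eq_of_pushforward_comp_eq (JK (bN c')) (fun h : ↥(H c') => (h : Aut (EN c'))) (tu c') (hq c') P₀ ?_
    have h := congrArg (fun f => ιN c' ≫ f) hab
    simp only [Preadditive.sum_comp, Preadditive.comp_sum, Category.assoc] at h
    rw [Finset.sum_eq_single c', Finset.sum_eq_single c', reassoc_of% (hιπN c'), reassoc_of% (hιπN c')] at h
    · exact h
    all_goals first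
      | (intro c _ hc; rw [reassoc_of% (hιπN' c' c (Ne.symm hc)), zero_comp])
      | (intro h'; exact absurd (Finset.mem_univ _) h')
  -- every piece of `X` lies under a piece of `X′`
  have hsurj : Function.Surjective bN := by
    intro c
    haveI : IrreducibleSpace (specOver ℂ ℂ).left := inferInstanceAs (IrreducibleSpace (PrimeSpectrum ℂ))
    obtain ⟨z⟩ := (hEK c).nonempty_algPoints ℂ
    obtain ⟨x, hx⟩ := IsSepQuotient.surjective_map_of_isProjectiveOver act p hX' hX hp (AlgPoints.map (eK c) z)
    obtain ⟨φ, x', hx'⟩ := Over.exists_pieceMap_of_isColimit_cofan_of_irreducibleSpace hcN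
      (X' := fun _ : Unit => specOver ℂ ℂ) (fun _ => 𝟙 _) x
    refine ⟨φ (), ?_⟩
    have hpt : AlgPoints.map (eK (bN (φ ()))) (AlgPoints.map (tu (φ ())) (x' ())) = AlgPoints.map (eK c) z := by
      rw [← AlgPoints.map_comp_apply, htu, AlgPoints.map_comp_apply, AlgPoints.map_apply (eN _), hx' (),
        Category.id_comp, hx]
    exact pieceIndex_unique eK hcK (T := specOver ℂ ℂ) (q := AlgPoints.map (eK c) z) _ z hpt rfl
  have hι' : ∀ c, ιK c ≫ a = ιK c ≫ b := fun c => by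
    obtain ⟨c', rfl⟩ := hsurj c
    exact hι c'
  have hexp : ∀ f : YK ⟶ Z, f = ∑ c, πK c ≫ ιK c ≫ f := fun f => by
    conv_lhs => rw [← Category.id_comp f, ← htotK, Preadditive.sum_comp]
    simp only [Category.assoc]
  rw [hexp a, hexp b]
  exact Finset.sum_congr rfl fun c _ => by rw [hι' c]

open scoped Classical in
/-- **Deck invariance for ANY pinned entries**: under the hypotheses of `fan_pinning_of_pinned` and `fan_word_cancel`, `Wt[T] ≫ W_d = Wt[T]` for
every `d ∈ Δ` and every lift family `(cs, dk)` of `act d` (`Wu ≫ Wt ≫ W_d = (Σ_δ W_δ) ≫ W_d = Σ_δ W_δ = Wu ≫ Wt` by ★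
`Jacobian.sum_pieceLift_word_comp_eq`, then cancel `Wu`) — `p^*` followed by a deck transformation is `p^*` ([LangeRodriguez2022] Prop. 3.5.1).
[cite: LangeRodriguez2022, §3.5.1 Prop. 3.5.1 (p. 65)] [cite: Lang1983AbelianVarieties, Ch. VIII §6, Thm. 13 (pp. 224–227)] -/
theorem Jacobian.fan_deck_of_pinned {YN YK : AbelianVariety ℂ}
    (πN : ∀ c, YN ⟶ (JN c).J) (ιN : ∀ c, (JN c).J ⟶ YN) (πK : ∀ c, YK ⟶ (JK c).J) (ιK : ∀ c, (JK c).J ⟶ YK)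
    (hιπN : ∀ c, ιN c ≫ πN c = 𝟙 _) (hιπN' : ∀ c₁ c₂, c₁ ≠ c₂ → ιN c₁ ≫ πN c₂ = 0)
    (htotK : ∑ c, πK c ≫ ιK c = 𝟙 YK) (hιπK : ∀ c, ιK c ≫ πK c = 𝟙 _) (hιπK' : ∀ c₁ c₂, c₁ ≠ c₂ → ιK c₁ ≫ πK c₂ = 0)
    (hX' : IsProjectiveOver X') (hX : IsSeparated X.hom) (hp : IsSepQuotient (fun δ => act δ) p)
    (hcN : IsColimit (Cofan.mk X' eN)) (hEN : ∀ c, IsSmoothProjective 1 (EN c))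
    (hcK : IsColimit (Cofan.mk X eK)) (hEK : ∀ c, IsSmoothProjective 1 (EK c))
    (htu : ∀ c', tu c' ≫ eK (bN c') = eN c' ≫ p)
    (φδ : Δ → CN → CN) (tδ : ∀ δ c', EN c' ⟶ EN (φδ δ c'))
    (htδ : ∀ δ c', tδ δ c' ≫ eN (φδ δ c') = eN c' ≫ (act δ).hom)
    (T : ∀ c', (JK (bN c')).J ⟶ (JN c').J)
    (hT : ∀ c', (JN c').pushforward (JK (bN c')) (tu c') ≫ T c' =
      ∑ δ : Δ, if hℓ : ∃ ℓ : EN c' ⟶ EN c', ℓ ≫ eN c' = eN c' ≫ (act δ).hom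
        then (JN c').pushforward (JN c') hℓ.choose else 0)
    (H : ∀ c', Subgroup (Aut (EN c'))) (hq : ∀ c', IsSepQuotient (fun h : ↥(H c') => (h : Aut (EN c'))) (tu c'))
    (d : Δ) (cs : CN → CN) (dk : ∀ c, EN c ⟶ EN (cs c)) (hdk : ∀ c, dk c ≫ eN (cs c) = eN c ≫ (act d).hom) :
    (∑ c', πK (bN c') ≫ T c' ≫ ιN c') ≫ (∑ c, πN c ≫ (JN c).pushforward (JN (cs c)) (dk c) ≫ ιN (cs c)) =
      ∑ c', πK (bN c') ≫ T c' ≫ ιN c' := by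
  haveI : ∀ c, IsIntegral (EN c).left := fun c => IsSmoothProjective.isIntegral_holds (hEN c)
  refine Jacobian.fan_word_cancel act p EN eN JN EK eK JK bN tu πN ιN πK ιK hιπN hιπN' htotK hX' hX hp hcN hEN hcK hEK htu H hq ?_
  rw [← Category.assoc, Jacobian.fan_pinning_of_pinned act p EN eN JN EK eK JK bN tu πN ιN πK ιK hιπK hιπK' hX' hX hp hcN
    hEN hcK hEK htu φδ tδ htδ T hT]
  exact Jacobian.sum_pieceLift_word_comp_eq act EN eN JN πN ιN hιπN hιπN' hcN φδ tδ htδ d cs dk hdk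

omit [Fintype CK] in
open scoped Classical in
/-- **Per-piece Galois data with the multiplicity EXPOSED** — ★ `Jacobian.exists_piece_pullback_pinned` with its `∃ m` replaced by the explicit
count `Nat.card {δ : Δ // eN c′ ≫ (act δ).hom = eN c′}` (the POINTWISE STABILISER of the piece `c′`: `act δ` restricts to the identity of
`E_N c′`; = the kernel of the stabiliser action `Stab_Δ(c′) → Aut (E_N c′)` by uniqueness of lifts, ★ `Over.exists_stabilizer_action_on_piece`):
the faithful piece group `H ≤ Aut (E_N c′)`, the quotient property of `tu c′`, the pinned pull-back `ttH` (`Nm_{tu} ≫ ttH = Σ_{h ∈ H} h_*`,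
[Lang1983AbelianVarieties] VIII §6 Thm. 13) and `Nm_{tu} ≫ (#{δ | act δ|_{E_N c′} = 𝟙} • ttH) = Σ_{δ ∈ Δ} (lift of δ at c′ → c′)_*`.
[cite: Lang1983AbelianVarieties, Ch. VIII §6, Thm. 13 (pp. 224–227)] [cite: SGA1, Exp. V §1 Prop. 1.1, 1.8]
[cite: GortzWedhorn2020, §(3.5) Proposition 3.10 and Example 3.11 (p. 73)] -/
theorem Jacobian.exists_piece_pullback_pinned_card (hX' : IsProjectiveOver X') (hX : IsSeparated X.hom)
    (hp : IsSepQuotient (fun δ => act δ) p)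
    (hcN : IsColimit (Cofan.mk X' eN)) (hEN : ∀ c, IsSmoothProjective 1 (EN c))
    (hcK : IsColimit (Cofan.mk X eK)) (hEK : ∀ c, IsSmoothProjective 1 (EK c))
    (htu : ∀ c', tu c' ≫ eK (bN c') = eN c' ≫ p) (c' : CN) :
    ∃ (H : Subgroup (Aut (EN c'))) (_ : Finite ↥H)
      (_ : IsSepQuotient (fun h : ↥H => (h : Aut (EN c'))) (tu c'))
      (ttH : (JK (bN c')).J ⟶ (JN c').J), 0 < Nat.card {δ : Δ // eN c' ≫ (act δ).hom = eN c'} ∧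
      (haveI := Fintype.ofFinite ↥H;
        (JN c').pushforward (JK (bN c')) (tu c') ≫ ttH = ∑ h : ↥H, (JN c').pushforward (JN c') (h : Aut (EN c')).hom) ∧
      (JN c').pushforward (JK (bN c')) (tu c') ≫ ((Nat.card {δ : Δ // eN c' ≫ (act δ).hom = eN c'} : ℤ) • ttH) =
        ∑ δ : Δ, if hℓ : ∃ ℓ : EN c' ⟶ EN c', ℓ ≫ eN c' = eN c' ≫ (act δ).hom
          then (JN c').pushforward (JN c') hℓ.choose else 0 := by
  classical
  haveI : ∀ c, IsIntegral (EN c).left := fun c => IsSmoothProjective.isIntegral_holds (hEN c)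
  haveI : ∀ c, IsIntegral (EK c).left := fun c => IsSmoothProjective.isIntegral_holds (hEK c)
  haveI : ∀ c, Smooth (EK c).hom := fun c =>
    haveI := (hEK c).smoothOfRelativeDimension
    SmoothOfRelativeDimension.smooth 1 _
  -- uniqueness of lifts through the piece `c'`
  have huniq : ∀ {a a' : EN c' ⟶ EN c'} {g : EN c' ⟶ X'}, a ≫ eN c' = g → a' ≫ eN c' = g → a = a' :=
    fun h h' => pieceLift_unique eN hcN _ _ (h.trans h'.symm)
  -- the stabiliser action on the piece `c'`
  obtain ⟨Δi, ai, hai, hmem⟩ := Over.exists_stabilizer_action_on_piece hcN act c'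
  -- the piecewise quotient
  obtain ⟨H₀, hfin₀, h₁, h₂, hq₀⟩ := exists_subgroup_isSepQuotient_pieceMap' act p eN eK hX' hX hp hcN hcK
    (fun c => (hEN c).isProjectiveOver) (fun c => by haveI := (hEK c).isProjectiveOver.isProper; infer_instance)
    bN tu htu c'
  -- `H₀` is the image of the stabiliser action
  have hH : H₀ = ai.range := by
    ext h
    constructor
    · intro hh
      obtain ⟨g, hg⟩ := h₁ h hh
      have hgi : g ∈ Δi := (hmem g).2 ⟨h.hom, hg⟩
      exact ⟨⟨g, hgi⟩, Iso.ext (huniq (hai ⟨g, hgi⟩) hg)⟩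
    · rintro ⟨σ, rfl⟩
      obtain ⟨h', hh', hh'eq⟩ := h₂ (σ : Δ) (ai σ).hom (hai σ)
      have e : h' = ai σ := Iso.ext hh'eq
      exact e ▸ hh'
  subst hH
  letI hF : Fintype ↥ai.range := @Fintype.ofFinite _ hfin₀
  -- the pinned pull-back for the faithful piece group
  obtain ⟨ttH, httH⟩ := Jacobian.exists_pushforward_comp_eq_sum (dX := 1) (dY := 1) (hEN c') (hEK (bN c')) (JN c')
    (JK (bN c')) ai.range.subtype (tu c') hq₀
  -- the multiplicity: the pointwise stabiliser of the piece = the kernel of the stabiliser action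
  set m : ℕ := (Finset.univ.filter fun σ : ↥Δi => ai σ = 1).card with hm_def
  have hm_pos : 0 < m := Finset.card_pos.2 ⟨1, by simp⟩
  have hcard : Nat.card {δ : Δ // eN c' ≫ (act δ).hom = eN c'} = m := by
    have e : {δ : Δ // eN c' ≫ (act δ).hom = eN c'} ≃ {σ : ↥Δi // ai σ = 1} :=
      { toFun := fun δ =>
          have hδi : (δ : Δ) ∈ Δi := (hmem δ).2 ⟨𝟙 _, by rw [Category.id_comp]; exact δ.2.symm⟩
          ⟨⟨δ, hδi⟩, Iso.ext (huniq (hai ⟨δ, hδi⟩) (by change 𝟙 _ ≫ eN c' = _; rw [Category.id_comp]; exact δ.2.symm))⟩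
        invFun := fun σ => ⟨(σ.1 : Δ), by
          have h := hai σ.1
          rw [σ.2] at h
          change 𝟙 _ ≫ eN c' = _ at h
          exact ((Category.id_comp _).symm.trans h).symm⟩
        left_inv := fun δ => Subtype.ext rfl
        right_inv := fun σ => Subtype.ext (Subtype.ext rfl) }
    rw [Nat.card_congr e, Nat.card_eq_fintype_card, Fintype.card_subtype]
  refine ⟨ai.range, hfin₀, hq₀, ttH, hcard ▸ hm_pos, httH, ?_⟩
  rw [hcard, Preadditive.comp_zsmul, httH]
  -- the right-hand side as a sum over the stabiliser
  have hM : ∀ δ : Δ, (if hℓ : ∃ ℓ : EN c' ⟶ EN c', ℓ ≫ eN c' = eN c' ≫ (act δ).hom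
      then (JN c').pushforward (JN c') hℓ.choose else 0) =
      if hδ : δ ∈ (Δi : Set Δ) then (JN c').pushforward (JN c') (ai ⟨δ, hδ⟩).hom else 0 := by
    intro δ
    by_cases hδ : δ ∈ Δi
    · have hℓ : ∃ ℓ : EN c' ⟶ EN c', ℓ ≫ eN c' = eN c' ≫ (act δ).hom := (hmem δ).1 hδ
      rw [dif_pos hℓ, dif_pos (show δ ∈ (Δi : Set Δ) from hδ), huniq hℓ.choose_spec (hai ⟨δ, hδ⟩)]
    · have hℓ : ¬ ∃ ℓ : EN c' ⟶ EN c', ℓ ≫ eN c' = eN c' ≫ (act δ).hom := fun h => hδ ((hmem δ).2 h)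
      rw [dif_neg hℓ, dif_neg (show δ ∉ (Δi : Set Δ) from hδ)]
  rw [Finset.sum_congr rfl fun δ _ => hM δ]
  rw [Finset.sum_congr_set (Δi : Set Δ)
    (fun δ => if hδ : δ ∈ (Δi : Set Δ) then (JN c').pushforward (JN c') (ai ⟨δ, hδ⟩).hom else 0)
    (fun σ => (JN c').pushforward (JN c') (ai σ).hom) (fun δ hδ => dif_pos hδ) (fun δ hδ => dif_neg hδ)]
  -- fibre count of `ai : Δi →* Aut (EN c')` onto its range
  have hfib : ∀ b ∈ (Finset.univ : Finset ↥Δi).image ai,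
      (Finset.univ.filter fun σ : ↥Δi => ai σ = b).card = m := by
    intro b hb
    obtain ⟨σ, -, rfl⟩ := Finset.mem_image.1 hb
    exact MonoidHom.card_fiber_eq_of_mem_range ai ⟨σ, rfl⟩ ⟨1, map_one ai⟩
  have hcount : (∑ σ : ↥Δi, (JN c').pushforward (JN c') (ai σ).hom) =
      m • ∑ h : ↥ai.range, (JN c').pushforward (JN c') (h : Aut (EN c')).hom := by
    calc (∑ σ : ↥Δi, (JN c').pushforward (JN c') (ai σ).hom)
        = ∑ b ∈ (Finset.univ : Finset ↥Δi).image ai,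
            (Finset.univ.filter fun σ : ↥Δi => ai σ = b).card • (JN c').pushforward (JN c') b.hom :=
          Finset.sum_comp (fun a : Aut (EN c') => (JN c').pushforward (JN c') a.hom) ai
      _ = ∑ b ∈ (Finset.univ : Finset ↥Δi).image ai, m • (JN c').pushforward (JN c') b.hom :=
          Finset.sum_congr rfl fun b hb => by rw [hfib b hb]
      _ = m • ∑ b ∈ (Finset.univ : Finset ↥Δi).image ai, (JN c').pushforward (JN c') b.hom := by
          rw [Finset.smul_sum]
      _ = m • ∑ h : ↥ai.range, (JN c').pushforward (JN c') (h : Aut (EN c')).hom := by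
          congr 1
          exact Finset.sum_subtype (p := fun x => x ∈ ai.range) (F := hF) _
            (fun x => by simp only [Finset.mem_image, Finset.mem_univ, true_and, MonoidHom.mem_range])
            (fun a : Aut (EN c') => (JN c').pushforward (JN c') a.hom)
  change (m : ℤ) • ∑ h : ↥ai.range, (JN c').pushforward (JN c') (h : Aut (EN c')).hom =
    ∑ σ : ↥Δi, (JN c').pushforward (JN c') (ai σ).hom
  rw [hcount, natCast_zsmul]

end FanCard

end Literature.NumberTheory.Automorphic.Liu2021.AppendixC

end
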